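import Literature.Geometry.Riemannian.PolarGraphInjective
import Mathlib.Analysis.Calculus.FDeriv.Basic
import HarnessLib

/-!
# Polar-graph maps: the quantitative shell lemma and injectivity of differentials

Topic `Geometry/Riemannian` (elementary lemmas on normed spaces), continuing
`PolarGraphInjective.lean`. The shell lemma (radial growth dominates angular drift) is in fact
QUANTITATIVE: under the same finite-difference hypotheses, plus a lower bound `R ≥ R₀ > 0`,
`|ρ' - ρ| + ‖u - u'‖ ≤ K ‖R(ρ', u')Θ(ρ', u') - R(ρ, u)Θ(ρ, u)‖` for close directions
(`polarGraph_sub_le`). Consequently the polar-graph map is locally co-Lipschitz, and a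
differentiable map which is co-Lipschitz near a point has injective differential there
(`norm_le_of_coLipschitz_hasFDerivAt`, `injective_of_coLipschitz_hasFDerivAt`) — this yields the
immersion property of the interior surgery map of Weinstein's disk (Weinstein 1968, proof of the
main theorem, step (3)) without differentiating its formula.

## References

* A. Weinstein, Ann. of Math. (2) 87 (1968), 29–41. [cite: Weinstein1968]

Tags: [PolarGraph] [Immersion] [Weinstein1968]
-/

noncomputable section

open Set Function Filter Metric
open scoped Topology

namespace Literature.Geometry.Riemannian

variable {V : Type*} [NormedAddCommGroup V] [NormedSpace ℝ V]

/-- **Quantitative shell lemma.** With `Θ` unit-valued, `R ≥ R₀ > 0`, `u ↦ Θ(ρ, u)`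
`m`-co-Lipschitz and `ρ ↦ Θ(ρ, u)` `A`-Lipschitz, `R(ρ', u') - R(ρ, u) ≥ μ(ρ' - ρ) - B‖u - u'‖`
for `ρ ≤ ρ'` (all for directions `u, u' ∈ S` with `‖u - u'‖ < 1`), `m > 0`, `A, B ≥ 0`,
`A B < μ m`: for `ρ ≤ ρ'` in `J` and such `u, u'`,
`ρ' - ρ ≤ K₁ δ` and `‖u - u'‖ ≤ K₂ δ` where `δ = ‖R(ρ',u')Θ(ρ',u') - R(ρ,u)Θ(ρ,u)‖`,
`K₁ = (m R₀ + 2B)/(R₀ (μ m - A B))`, `K₂ = (2/R₀ + A K₁)/m`.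
[cite: Weinstein1968, proof of the main theorem, step (3)] -/
theorem polarGraph_sub_le {R : ℝ → V → ℝ} {Θ : ℝ → V → V} {J : Set ℝ} {S : Set V}
    {m A μ B R₀ : ℝ} (hm : 0 < m) (hA : 0 ≤ A) (hB : 0 ≤ B) (hdom : A * B < μ * m)
    (hR₀ : 0 < R₀)
    (hΘnorm : ∀ ρ ∈ J, ∀ u ∈ S, ‖Θ ρ u‖ = 1) (hRge : ∀ ρ ∈ J, ∀ u ∈ S, R₀ ≤ R ρ u)
    (hΘinj : ∀ ρ ∈ J, ∀ u ∈ S, ∀ u' ∈ S, ‖u - u'‖ < 1 → m * ‖u - u'‖ ≤ ‖Θ ρ u - Θ ρ u'‖)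
    (hΘρ : ∀ ρ ∈ J, ∀ ρ' ∈ J, ∀ u ∈ S, ‖Θ ρ u - Θ ρ' u‖ ≤ A * |ρ - ρ'|)
    (hR : ∀ ρ ∈ J, ∀ ρ' ∈ J, ρ ≤ ρ' → ∀ u ∈ S, ∀ u' ∈ S, ‖u - u'‖ < 1 →
      μ * (ρ' - ρ) - B * ‖u - u'‖ ≤ R ρ' u' - R ρ u)
    {ρ ρ' : ℝ} (hρ : ρ ∈ J) (hρ' : ρ' ∈ J) (hle : ρ ≤ ρ') {u u' : V} (hu : u ∈ S) (hu' : u' ∈ S)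
    (hclose : ‖u - u'‖ < 1) :
    ρ' - ρ ≤ (m * R₀ + 2 * B) / (R₀ * (μ * m - A * B)) * ‖R ρ' u' • Θ ρ' u' - R ρ u • Θ ρ u‖ ∧
      ‖u - u'‖ ≤ (2 / R₀ + A * ((m * R₀ + 2 * B) / (R₀ * (μ * m - A * B)))) / m *
        ‖R ρ' u' • Θ ρ' u' - R ρ u • Θ ρ u‖ := by
  set δ : ℝ := ‖R ρ' u' • Θ ρ' u' - R ρ u • Θ ρ u‖ with hδ
  have hδ0 : 0 ≤ δ := norm_nonneg _
  have hRu : R₀ ≤ R ρ u := hRge ρ hρ u hu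
  have hRu' : R₀ ≤ R ρ' u' := hRge ρ' hρ' u' hu'
  have hRpos : 0 < R ρ u := hR₀.trans_le hRu
  have hRpos' : 0 < R ρ' u' := hR₀.trans_le hRu'
  -- (a) `|R' - R| ≤ δ`
  have ha : |R ρ' u' - R ρ u| ≤ δ := by
    have h1 : ‖R ρ' u' • Θ ρ' u'‖ = R ρ' u' := by
      rw [norm_smul, hΘnorm ρ' hρ' u' hu', mul_one, Real.norm_eq_abs, abs_of_pos hRpos']
    have h2 : ‖R ρ u • Θ ρ u‖ = R ρ u := by
      rw [norm_smul, hΘnorm ρ hρ u hu, mul_one, Real.norm_eq_abs, abs_of_pos hRpos]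
    have h := abs_norm_sub_norm_le (R ρ' u' • Θ ρ' u') (R ρ u • Θ ρ u)
    rwa [h1, h2] at h
  -- (b) `‖Θ' - Θ‖ ≤ 2δ/R₀`
  have hb : ‖Θ ρ' u' - Θ ρ u‖ ≤ 2 * δ / R₀ := by
    have e : R ρ u • (Θ ρ' u' - Θ ρ u) =
        (R ρ' u' • Θ ρ' u' - R ρ u • Θ ρ u) - (R ρ' u' - R ρ u) • Θ ρ' u' := by
      rw [smul_sub, sub_smul]; abel
    have h1 : R ρ u * ‖Θ ρ' u' - Θ ρ u‖ ≤ δ + δ := by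
      have h := congrArg norm e
      rw [norm_smul, Real.norm_eq_abs, abs_of_pos hRpos] at h
      rw [h]
      refine (norm_sub_le _ _).trans (add_le_add le_rfl ?_)
      rw [norm_smul, hΘnorm ρ' hρ' u' hu', mul_one, Real.norm_eq_abs]
      exact ha
    rw [le_div_iff₀ hR₀]
    have h2 : ‖Θ ρ' u' - Θ ρ u‖ * R₀ ≤ ‖Θ ρ' u' - Θ ρ u‖ * R ρ u :=
      mul_le_mul_of_nonneg_left hRu (norm_nonneg _)
    linarith
  -- (c) `m ‖u - u'‖ ≤ 2δ/R₀ + A (ρ' - ρ)`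
  have hc : m * ‖u - u'‖ ≤ 2 * δ / R₀ + A * (ρ' - ρ) := by
    have h1 := hΘinj ρ hρ u hu u' hu' hclose
    have h2 : ‖Θ ρ u - Θ ρ u'‖ ≤ ‖Θ ρ u - Θ ρ' u'‖ + ‖Θ ρ' u' - Θ ρ u'‖ := norm_sub_le_norm_sub_add_norm_sub _ _ _
    have h3 : ‖Θ ρ u - Θ ρ' u'‖ ≤ 2 * δ / R₀ := by rw [norm_sub_rev]; exact hb
    have h4 := hΘρ ρ' hρ' ρ hρ u' hu'
    rw [abs_of_nonneg (sub_nonneg.2 hle)] at h4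
    linarith
  -- (d) `(μ m - A B)(ρ' - ρ) ≤ δ (m + 2B/R₀)`
  have hd : (μ * m - A * B) * (ρ' - ρ) ≤ δ * (m * R₀ + 2 * B) / R₀ := by
    have h1 := hR ρ hρ ρ' hρ' hle u hu u' hu' hclose
    have h2 : R ρ' u' - R ρ u ≤ δ := (le_abs_self _).trans ha
    -- `μ (ρ'-ρ) ≤ δ + B ‖u - u'‖ ≤ δ + (B/m)(2δ/R₀ + A(ρ'-ρ))`
    have h3 : m * (μ * (ρ' - ρ)) ≤ m * δ + B * (2 * δ / R₀ + A * (ρ' - ρ)) := by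
      have h4 : μ * (ρ' - ρ) ≤ δ + B * ‖u - u'‖ := by linarith
      have h5 : m * (B * ‖u - u'‖) ≤ B * (2 * δ / R₀ + A * (ρ' - ρ)) := by
        calc m * (B * ‖u - u'‖) = B * (m * ‖u - u'‖) := by ring
          _ ≤ B * (2 * δ / R₀ + A * (ρ' - ρ)) := mul_le_mul_of_nonneg_left hc hB
      nlinarith
    have h6 : (μ * m - A * B) * (ρ' - ρ) ≤ m * δ + B * (2 * δ / R₀) := by nlinarith
    have e : m * δ + B * (2 * δ / R₀) = δ * (m * R₀ + 2 * B) / R₀ := by field_simp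
    linarith
  have hgap : 0 < μ * m - A * B := by linarith
  have h1 : ρ' - ρ ≤ (m * R₀ + 2 * B) / (R₀ * (μ * m - A * B)) * δ := by
    rw [div_mul_eq_mul_div, le_div_iff₀ (mul_pos hR₀ hgap)]
    have := hd
    rw [le_div_iff₀ hR₀] at this
    nlinarith
  refine ⟨h1, ?_⟩
  -- (e) `‖u - u'‖ ≤ (2δ/R₀ + A (ρ' - ρ))/m`
  rw [div_mul_eq_mul_div, le_div_iff₀ hm]
  have h2 : A * (ρ' - ρ) ≤ A * ((m * R₀ + 2 * B) / (R₀ * (μ * m - A * B)) * δ) :=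
    mul_le_mul_of_nonneg_left h1 hA
  have e : (2 / R₀ + A * ((m * R₀ + 2 * B) / (R₀ * (μ * m - A * B)))) * δ =
      2 * δ / R₀ + A * ((m * R₀ + 2 * B) / (R₀ * (μ * m - A * B)) * δ) := by ring
  rw [e]
  linarith

/-- **A co-Lipschitz differentiable map has co-Lipschitz differential**: if
`c‖y - x‖ ≤ ‖F y - F x‖` for `y` near `x` and `F` has derivative `F'` at `x`, then
`c‖z‖ ≤ ‖F' z‖` for all `z`. [folklore] -/
theorem norm_le_of_coLipschitz_hasFDerivAt {W : Type*} [NormedAddCommGroup W] [NormedSpace ℝ W]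
    {F : V → W} {F' : V →L[ℝ] W} {x : V} {c : ℝ}
    (hco : ∀ᶠ y in 𝓝 x, c * ‖y - x‖ ≤ ‖F y - F x‖) (hF : HasFDerivAt F F' x) (z : V) :
    c * ‖z‖ ≤ ‖F' z‖ := by
  by_cases hz : z = 0
  · subst hz; simp
  -- along the line `t ↦ x + t z`
  have hzn : 0 < ‖z‖ := norm_pos_iff.2 hz
  by_contra hlt
  rw [not_le] at hlt
  -- `ε = (c‖z‖ - ‖F' z‖)/2 > 0`
  set η : ℝ := (c * ‖z‖ - ‖F' z‖) / 2 with hη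
  have hηpos : 0 < η := by rw [hη]; linarith
  have hlittle := hF.isLittleO
  rw [Asymptotics.isLittleO_iff] at hlittle
  have h1 := hlittle (c := η / ‖z‖) (div_pos hηpos hzn)
  -- restrict to the line
  have hline : Tendsto (fun t : ℝ ↦ x + t • z) (𝓝 0) (𝓝 x) := by
    have : Continuous fun t : ℝ ↦ x + t • z := continuous_const.add (continuous_id.smul continuous_const)
    simpa using this.tendsto 0
  have h2 := hline.eventually h1
  have h3 := hline.eventually hco
  have h4 : ∀ᶠ t : ℝ in 𝓝 0, 0 < t → False := by
    filter_upwards [h2, h3] with t ht2 ht3 htpos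
    simp only [add_sub_cancel_left] at ht2 ht3
    rw [norm_smul, Real.norm_eq_abs, abs_of_pos htpos] at ht2 ht3
    -- `‖F(x+tz) - F x - t F' z‖ ≤ (η/‖z‖) t ‖z‖ = η t`
    have e1 : η / ‖z‖ * (t * ‖z‖) = η * t := by field_simp
    rw [map_smul, e1] at ht2
    -- `c t ‖z‖ ≤ ‖F(x+tz) - F x‖ ≤ ‖t F' z‖ + η t`
    have h5 : ‖F (x + t • z) - F x‖ ≤ t * ‖F' z‖ + η * t := by
      have h := norm_sub_le_norm_sub_add_norm_sub (F (x + t • z) - F x) (t • F' z) 0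
      simp only [sub_zero, norm_smul, Real.norm_eq_abs, abs_of_pos htpos] at h
      have h6 : ‖F (x + t • z) - F x - t • F' z‖ ≤ η * t := ht2
      calc ‖F (x + t • z) - F x‖ = ‖(F (x + t • z) - F x - t • F' z) + t • F' z‖ := by
            rw [sub_add_cancel]
        _ ≤ ‖F (x + t • z) - F x - t • F' z‖ + ‖t • F' z‖ := norm_add_le _ _
        _ ≤ η * t + t * ‖F' z‖ := by
            rw [norm_smul, Real.norm_eq_abs, abs_of_pos htpos]; linarith
        _ = t * ‖F' z‖ + η * t := by ring
    have h7 : c * (t * ‖z‖) ≤ t * ‖F' z‖ + η * t := ht3.trans h5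
    -- contradiction with `η = (c‖z‖ - ‖F'z‖)/2`
    have h8 : c * ‖z‖ * t ≤ (‖F' z‖ + η) * t := by nlinarith
    have h9 : c * ‖z‖ ≤ ‖F' z‖ + η := le_of_mul_le_mul_right h8 htpos
    rw [hη] at h9
    linarith
  -- there are positive `t` arbitrarily close to `0`
  obtain ⟨s, hs, hsub⟩ := Metric.eventually_nhds_iff.1 h4
  have := hsub (y := s / 2) (by rw [Real.dist_eq, sub_zero, abs_of_pos (by linarith)]; linarith)
    (by linarith)
  exact this

/-- **A co-Lipschitz differentiable map has injective differential.** [folklore] -/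
theorem injective_of_coLipschitz_hasFDerivAt {W : Type*} [NormedAddCommGroup W]
    [NormedSpace ℝ W] {F : V → W} {F' : V →L[ℝ] W} {x : V} {c : ℝ} (hc : 0 < c)
    (hco : ∀ᶠ y in 𝓝 x, c * ‖y - x‖ ≤ ‖F y - F x‖) (hF : HasFDerivAt F F' x) :
    Injective F' := by
  rw [injective_iff_map_eq_zero]
  intro z hz
  have h := norm_le_of_coLipschitz_hasFDerivAt hco hF z
  rw [hz, norm_zero] at h
  have : ‖z‖ ≤ 0 := by nlinarith
  exact norm_le_zero_iff.1 this

end Literature.Geometry.Riemannian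

end
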